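import Summits.PneNP.PneNP.Theorems.SzkEntropyPeaThreeNotInPStubGap
import Summits.PneNP.PneNP.Theorems.SzkEntropyPeaThreeNotInPStubSemantics
import Summits.PneNP.PneNP.Theorems.SzkEntropyPeaThreeNotInPStubInstanceFP
import Summits.PneNP.PneNP.Theorems.SzkEntropyPeaThreeNotInPStubPedCookPea
import Summits.PneNP.PneNP.Theorems.SzkEntropyPeaThreeNotInPKillSwitch
import Literature.Computability.Complexity.PromiseCookReductionsProofs
import Literature.Computability.Complexity.PromiseProofs
import Literature.Computability.Complexity.PromiseBPPClosureProofs
import Literature.Computability.Complexity.PromiseZPPProofs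
import Literature.Computability.Complexity.PEADegreeReduction

/-!
# Route SzkEntropy, crux `PeaThreeNotInP` (stmt-PneNP-10776), line `SketchIdeator3`: the transfer
# `TensorIso ∉ PromiseP → PeaThreeNotInP` (registered stub `stub_transfer`)

The certified reduction chain of the tensor-isomorphism line:

  `TensorIso.swap ≤ₚ PED 4`  (`tensorIso_swap_polyTimeReducible_PED`: entropy bookkeeping of the
                              `PED 4` instance `pedOf = (pedP, pedQ)` from `stub_semantics` and
                              `stub_gap`; the guard `guardOK_of_concise`; the `FP` map `stub_instanceFP`)
  `PED 4 ≤_Cook PEA 4`        (`stub_pedCookPea`, Dvir–Gutfreund–Rothblum–Vadhan §3)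
  `PEA 4 ≤ₚ PEA 3`            (tree: `PEA_polyTimeReducible_PEA_three`, proved)
  closures of `PromiseP`      (tree: `mem_PromiseP_of_cookReducible_holds`,
                              `mem_PromiseP_of_polyTimeReducible_holds`, `compl_mem_P_iff`)

hence **`stub_transfer`**: `PEA 3 ∈ PromiseP → TensorIso ∈ PromiseP`, and the honest conditional
**`peaThreeNotInP_of_tensorIso`**: `TensorIso ∉ PromiseP → PeaThreeNotInP` — hardness of 3-Tensor
Isomorphism over `F₂` (non-isomorphic side promised concise; an OPEN conjecture, GI-hard, the transfer
hypothesis C⁺ of the line) gives thesis X; and the RANDOMISED rider pricing the route's kill switch: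
`tensorIso_mem_PromiseBPP'_of_PEA_three` / **`not_peaThreeMemBPP_of_tensorIso`** — refuting X through
`PeaThreeMemBPP` (`PEA 3 ∈ PromiseBPP'`) forces `TensorIso ∈ PromiseBPP'` (the same chain through the
PROVED closures of textbook promise-`BPP` under Karp/Cook reductions and `swap`).  Sources: the line cards
`Cruxes/PeaThreeNotInP/Ideas/tensor-iso-monoid-import.md`, `…/tensor-orbit-two-query.md`; DGRV 2010 §3.
-/

noncomputable section

open Finset Matrix
open scoped Kronecker
open _root_.Computability
open Literature.InformationTheory.Entropy
open Literature.Computability.Complexity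

namespace Summit.PneNP.PneNP.Cruxes.PeaThreeNotInP.TensorIsoLine

set_option linter.dupNamespace false -- `Summit.PneNP.PneNP.…`: summit = sub-problem name (D-0017 single-conjunct layout)

variable {a b c : ℕ}

/-! ### Iterated products -/

/-- `H(P^{×t}) = t · H(P)`. [DvirGutfreundRothblumVadhan2010, §3 p.6] -/
theorem entropy_powMap {n : ℕ} (P : PolyMapF2 n) : ∀ t : ℕ, (powMap P t).entropy = t * P.entropy
  | 0 => by
    change PolyMapF2.entropy ([] : PolyMapF2 (n * 0)) = _
    rw [PolyMapF2.entropy_nil]; simp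
  | t + 1 => by
    change ((powMap P t).prod P).entropy = _
    rw [PolyMapF2.entropy_prod, entropy_powMap P t]
    push_cast
    ring

/-- The degree bound is preserved by iterated products. [DvirGutfreundRothblumVadhan2010, §3 p.6] -/
theorem degLE_powMap {n d : ℕ} {P : PolyMapF2 n} (h : P.DegLE d) :
    ∀ t : ℕ, (powMap P t).DegLE d
  | 0 => by
    change PolyMapF2.DegLE d ([] : PolyMapF2 (n * 0))
    exact PolyMapF2.degLE_nil d
  | t + 1 => by
    change ((powMap P t).prod P).DegLE d
    exact (degLE_powMap h t).prod h

/-! ### Entropy bookkeeping of the `PED 4` instance -/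

/-- `H(pedP) = 128 · H(mixMap)`. [card tensor-iso-monoid-import] -/
theorem entropy_pedP (S T : Tensor3 a b c) : (pedP S T).2.entropy = 128 * mixEntropy S T := by
  change (powMap (mixMap S T) 128).entropy = _
  rw [entropy_powMap, (stub_semantics S T).2.2.2]
  norm_num

/-- `H(pedQ) = 64 · H_S + 64 · H_T + 1`. [card tensor-iso-monoid-import] -/
theorem entropy_pedQ (S T : Tensor3 a b c) :
    (pedQ S T).2.entropy = 64 * samplerEntropy S + 64 * samplerEntropy T + 1 := by
  change ((powMap (orbitMap S) 64).prod ((powMap (orbitMap T) 64).prod (PolyMapF2.idMap 1))).entropy = _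
  rw [PolyMapF2.entropy_prod, PolyMapF2.entropy_prod, entropy_powMap, entropy_powMap,
    (stub_semantics S S).2.1, (stub_semantics T T).2.1, PolyMapF2.entropy_idMap]
  push_cast
  ring

/-- `pedP` has degree `≤ 4`. [card tensor-iso-monoid-import] -/
theorem degLE_pedP (S T : Tensor3 a b c) : (pedP S T).2.DegLE 4 := by
  change (powMap (mixMap S T) 128).DegLE 4
  exact degLE_powMap (stub_semantics S T).2.2.1 128

/-- `pedQ` has degree `≤ 4`. [card tensor-iso-monoid-import] -/
theorem degLE_pedQ (S T : Tensor3 a b c) : (pedQ S T).2.DegLE 4 := by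
  change ((powMap (orbitMap S) 64).prod ((powMap (orbitMap T) 64).prod (PolyMapF2.idMap 1))).DegLE 4
  refine (degLE_powMap ((stub_semantics S S).1.mono (by norm_num)) 64).prod
    ((degLE_powMap ((stub_semantics T T).1.mono (by norm_num)) 64).prod
      (PolyMapF2.degLE_idMap (by norm_num) 1))

/-- **YES ↦ YES**: concise non-isomorphic pairs go to yes-instances of `PED 4`
(`H(pedP) ≥ H(pedQ) + 1`). [card tensor-iso-monoid-import] -/
theorem pedOf_mem_PED_yes {I : TIInst} (hS : Concise I.fstT) (hT : Concise I.sndT)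
    (h : ¬ Iso I.fstT I.sndT) : PEDInst.encoding.encode (pedOf I) ∈ (PED 4).yes := by
  rw [encode_mem_PED_yes_iff]
  refine ⟨degLE_pedP _ _, degLE_pedQ _ _, ?_⟩
  change (pedQ I.fstT I.sndT).2.entropy + 1 ≤ (pedP I.fstT I.sndT).2.entropy
  rw [entropy_pedP, entropy_pedQ]
  have := (stub_gap I.fstT I.sndT).1 hS hT h
  linarith

/-- **NO ↦ NO**: isomorphic pairs go to no-instances of `PED 4` (`H(pedP) + 1 ≤ H(pedQ)`, in fact
equality). [card tensor-iso-monoid-import] -/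
theorem pedOf_mem_PED_no {I : TIInst} (h : Iso I.fstT I.sndT) :
    PEDInst.encoding.encode (pedOf I) ∈ (PED 4).no := by
  rw [encode_mem_PED_no_iff]
  refine ⟨degLE_pedP _ _, degLE_pedQ _ _, ?_⟩
  change (pedP I.fstT I.sndT).2.entropy + 1 ≤ (pedQ I.fstT I.sndT).2.entropy
  rw [entropy_pedP, entropy_pedQ, mixEntropy_eq_of_iso h, samplerEntropy_eq_of_iso h]
  linarith

/-! ### The guard: conciseness bounds the formats by the support length -/

/-- A matrix whose rows vanish outside a finite set of row indices has rank at most the size of that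
set. [folklore] -/
theorem rank_le_card_of_rows_eq_zero {m : ℕ} {ν : Type} [Fintype ν] [DecidableEq ν]
    (Y : Matrix (Fin m) ν (ZMod 2)) (s : Finset (Fin m)) (hs : ∀ i, i ∉ s → Y i = 0) :
    Y.rank ≤ s.card := by
  classical
  rw [Matrix.rank_eq_finrank_span_row]
  have hsub : Set.range Y.row ⊆
      insert (0 : ν → ZMod 2) ((s.image fun i => Y i : Finset (ν → ZMod 2)) : Set (ν → ZMod 2)) := by
    rintro _ ⟨i, rfl⟩
    by_cases hi : i ∈ s
    · refine Set.mem_insert_of_mem _ ?_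
      rw [Finset.coe_image]
      exact ⟨i, hi, rfl⟩
    · rw [Set.mem_insert_iff]
      exact Or.inl (hs i hi)
  calc Module.finrank (ZMod 2) (Submodule.span (ZMod 2) (Set.range Y.row))
      ≤ Module.finrank (ZMod 2) (Submodule.span (ZMod 2)
          (insert (0 : ν → ZMod 2) ((s.image fun i => Y i : Finset (ν → ZMod 2)) : Set (ν → ZMod 2)))) :=
        Submodule.finrank_mono (Submodule.span_mono hsub)
    _ = Module.finrank (ZMod 2) (Submodule.span (ZMod 2)
          ((s.image fun i => Y i : Finset (ν → ZMod 2)) : Set (ν → ZMod 2))) := by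
        rw [Submodule.span_insert_zero]
    _ ≤ (s.image fun i => Y i).card := finrank_span_finset_le_card _
    _ ≤ s.card := Finset.card_image_le

/-- The first flattening rank of a support tensor is at most the support length. [folklore] -/
theorem rank_ofSupport_le (L : List (Fin a × (Fin b × Fin c))) : (ofSupport L).rank ≤ L.length := by
  classical
  refine (rank_le_card_of_rows_eq_zero (ofSupport L) (L.map Prod.fst).toFinset ?_).trans
    ((List.toFinset_card_le _).trans (List.length_map _).le)
  intro i hi
  funext jk
  simp only [ofSupport, Matrix.of_apply, Pi.zero_apply]
  rw [if_neg]
  intro hmem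
  exact hi (List.mem_toFinset.2 (List.mem_map.2 ⟨(i, jk), hmem, rfl⟩))

/-- The second flattening rank of a support tensor is at most the support length. [folklore] -/
theorem rank_flat₂_ofSupport_le (L : List (Fin a × (Fin b × Fin c))) :
    (flat₂ (ofSupport L)).rank ≤ L.length := by
  classical
  refine (rank_le_card_of_rows_eq_zero (flat₂ (ofSupport L)) (L.map fun p => p.2.1).toFinset ?_).trans
    ((List.toFinset_card_le _).trans (List.length_map _).le)
  intro j hj
  funext ik
  simp only [flat₂, ofSupport, Matrix.of_apply, Pi.zero_apply]
  rw [if_neg]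
  intro hmem
  exact hj (List.mem_toFinset.2 (List.mem_map.2 ⟨(ik.1, (j, ik.2)), hmem, rfl⟩))

/-- The third flattening rank of a support tensor is at most the support length. [folklore] -/
theorem rank_flat₃_ofSupport_le (L : List (Fin a × (Fin b × Fin c))) :
    (flat₃ (ofSupport L)).rank ≤ L.length := by
  classical
  refine (rank_le_card_of_rows_eq_zero (flat₃ (ofSupport L)) (L.map fun p => p.2.2).toFinset ?_).trans
    ((List.toFinset_card_le _).trans (List.length_map _).le)
  intro k hk
  funext ij
  simp only [flat₃, ofSupport, Matrix.of_apply, Pi.zero_apply]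
  rw [if_neg]
  intro hmem
  exact hk (List.mem_toFinset.2 (List.mem_map.2 ⟨(ij.1, (ij.2, k)), hmem, rfl⟩))

/-- **Concise first tensors pass the guard**: each format is a flattening rank of
`ofSupport L_S`, hence at most `|L_S|`. [folklore] -/
theorem guardOK_of_concise {I : TIInst} (h : Concise I.fstT) : guardOK I = true := by
  obtain ⟨h1, h2, h3⟩ := h
  have ha : I.1 ≤ I.2.2.2.1.length := by
    have := rank_ofSupport_le I.2.2.2.1
    unfold TIInst.fstT at h1
    omega
  have hb : I.2.1 ≤ I.2.2.2.1.length := by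
    have := rank_flat₂_ofSupport_le I.2.2.2.1
    unfold TIInst.fstT at h2
    omega
  have hc : I.2.2.1 ≤ I.2.2.2.1.length := by
    have := rank_flat₃_ofSupport_le I.2.2.2.1
    unfold TIInst.fstT at h3
    omega
  simp [guardOK, ha, hb, hc]

/-- **`coTensorIso ≤ₚ PED 4`**: the swapped problem (YES = concise non-isomorphic pairs, NO =
isomorphic pairs) Karp-reduces to `PED 4` by the guarded map `pedOfG`. [card tensor-iso-monoid-import] -/
theorem tensorIso_swap_polyTimeReducible_PED : TensorIso.swap.PolyTimeReducible (PED 4) := by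
  obtain ⟨f, hf, hspec⟩ := stub_instanceFP
  refine ⟨f, hf, ?_, ?_⟩
  · rintro w ⟨I, ⟨hS, hT, hI⟩, rfl⟩
    show f (TIInst.encoding.encode I) ∈ (PED 4).yes
    rw [hspec, pedOfG, if_pos (guardOK_of_concise hS)]
    exact pedOf_mem_PED_yes hS hT hI
  · rintro w ⟨I, hI, rfl⟩
    show f (TIInst.encoding.encode I) ∈ (PED 4).no
    rw [hspec, pedOfG]
    by_cases hg : guardOK I = true
    · rw [if_pos hg]
      exact pedOf_mem_PED_no hI
    · rw [if_neg hg]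
      exact PEAToPED.noInst_mem_no (by norm_num)

/-- `PEA d ∈ PromiseP → PED d ∈ PromiseP` (Cook closure). [DvirGutfreundRothblumVadhan2010, §3 p.6;
Goldreich2006, §1.2 remark after Def. 3] -/
theorem PED_mem_PromiseP_of_PEA {d : ℕ} (h : PEA d ∈ PromiseP) : PED d ∈ PromiseP :=
  PromiseProblem.mem_PromiseP_of_cookReducible_holds _ _ (stub_pedCookPea d) h

/-- **stub_transfer** (registered stub of the line) — the certified reduction chain: a
polynomial-time separator for `PEA 3` yields one for `TensorIso` (`TensorIso.swap ≤ₚ PED 4 ≤_Cook PEA 4 ≤ₚ PEA 3`, and `P` is closed under complement).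
[card tensor-iso-monoid-import, Transfer] -/
theorem stub_transfer (h3 : PEA 3 ∈ PromiseP) : TensorIso ∈ PromiseP := by
  have h4 : PEA 4 ∈ PromiseP :=
    PromiseProblem.mem_PromiseP_of_polyTimeReducible_holds (PEA_polyTimeReducible_PEA_three 4) h3
  have hPED : PED 4 ∈ PromiseP := PED_mem_PromiseP_of_PEA h4
  have hsw : TensorIso.swap ∈ PromiseP :=
    PromiseProblem.mem_PromiseP_of_polyTimeReducible_holds tensorIso_swap_polyTimeReducible_PED hPED
  obtain ⟨L, hL, hy, hn⟩ := hsw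
  refine ⟨Lᶜ, compl_mem_P_iff.2 hL, ?_, ?_⟩
  · intro w hw
    exact hn hw
  · intro w hw
    simpa using hy hw

/-- **The randomised chain**: a promise-`BPP` algorithm for `PEA 3` yields one for `TensorIso`
(closures of textbook promise-`BPP` under Karp and Cook reductions and under `swap`, all proved in the
tree). [card entropy-gap-sockets (prBPP' rider); Goldreich2006, §1.2 remark after Def. 3] -/
theorem tensorIso_mem_PromiseBPP'_of_PEA_three (h3 : PEA 3 ∈ PromiseBPP') : TensorIso ∈ PromiseBPP' := by
  have h4 : PEA 4 ∈ PromiseBPP' :=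
    PromiseProblem.mem_PromiseBPP'_of_polyTimeReducible_holds' (PEA_polyTimeReducible_PEA_three 4) h3
  have hPED : PED 4 ∈ PromiseBPP' :=
    PromiseProblem.mem_PromiseBPP'_of_cookReducible_holds _ _ (stub_pedCookPea 4) h4
  have hsw : TensorIso.swap ∈ PromiseBPP' :=
    PromiseProblem.mem_PromiseBPP'_of_polyTimeReducible_holds' tensorIso_swap_polyTimeReducible_PED hPED
  simpa using swap_mem_PromiseBPP' hsw

/-- **Price of the kill switch**: the route's randomised escape `PeaThreeMemBPP` (`PEA 3 ∈ PromiseBPP'`)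
puts 3-Tensor Isomorphism over `F₂` (non-isomorphic side promised concise) in promise-`BPP`.
[card entropy-gap-sockets (prBPP' rider); card tensor-iso-monoid-import] -/
theorem not_peaThreeMemBPP_of_tensorIso (hTI : TensorIso ∉ PromiseBPP') :
    ¬ Summit.PneNP.PneNP.Theses.SzkEntropy.PeaThreeMemBPP := fun h =>
  hTI (tensorIso_mem_PromiseBPP'_of_PEA_three
    (Summit.PneNP.PneNP.Theorems.szkEntropy_peaThreeMemBPP_iff.1 h))

/-- **Transfer: hardness of 3-Tensor Isomorphism over `F₂` (non-isomorphic side promised concise)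
gives thesis X** (`PEA 3 ∉ PromiseP`).  The hypothesis is the line's transfer hypothesis C⁺ — an open
conjecture (GI-hard; TI-complete family of Grochow–Qiao), NOT claimed here.
[card tensor-iso-monoid-import, Transfer] -/
theorem peaThreeNotInP_of_tensorIso (hTI : TensorIso ∉ PromiseP) :
    Summit.PneNP.PneNP.Theses.SzkEntropy.PeaThreeNotInP :=
  Summit.PneNP.PneNP.Theorems.szkEntropy_peaThreeNotInP_iff.2 fun h3 => hTI (stub_transfer h3)

end Summit.PneNP.PneNP.Cruxes.PeaThreeNotInP.TensorIsoLine

end
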